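import Mathlib

/-!
# Route VeryGoodTransfer — proof of the split child `CubeMonomialIntegrability` (X₂, analysis)

The second piece of the typed split of `RationalRepsResolve` (crux-strategist, BC2 redirect), stated
verbatim: if `u` is continuous and non-vanishing on an open `U ⊇ closure C`, `C = (0,1)ⁿ` the open unit
cube, and `x ↦ u x · ∏ⱼ xⱼ ^ aⱼ` (`aⱼ ∈ ℤ`) is integrable on `C`, then every `aⱼ ≥ 0` — the monomial
argument "absolute convergence ⇒ exponents ≥ 0" of Huber–Müller-Stach, *Periods and Nori motives*,
Part III (2015 draft), Lemma 11.2.2. Proof: `|u| ≥ c > 0` on the compact closed cube strips the unit;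
split off the coordinate `j` by the measure-preserving `MeasurableEquiv.piFinSuccAbove`; by Tonelli
(`lintegral_prod_mul`) and positivity of both factors, `t ↦ t ^ aⱼ` is integrable on `(0,1)`, so
`aⱼ ≥ 0` (`intervalIntegral.integrableOn_Ioo_rpow_iff`).
-/

noncomputable section

open MeasureTheory Set Filter
open scoped ENNReal Topology

namespace Summit.KontsevichZagierPeriods.VeryGoodTransfer.CubeMonomialIntegrabilityProof

/-- `t ↦ t ^ a` (`a : ℤ`) is integrable on `(0,1)` iff `0 ≤ a`. [folklore] -/
theorem integrableOn_zpow_Ioo_iff (a : ℤ) :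
    IntegrableOn (fun t : ℝ => t ^ a) (Ioo (0:ℝ) 1) ↔ 0 ≤ a := by
  have h := intervalIntegral.integrableOn_Ioo_rpow_iff (s := (a : ℝ)) zero_lt_one
  have hcongr : IntegrableOn (fun t : ℝ => t ^ a) (Ioo (0:ℝ) 1) ↔
      IntegrableOn (fun t : ℝ => t ^ (a : ℝ)) (Ioo (0:ℝ) 1) := by
    refine integrableOn_congr_fun (fun t _ => ?_) measurableSet_Ioo
    rw [Real.rpow_intCast]
  rw [hcongr, h]
  constructor
  · intro h'
    have : (-1 : ℤ) < a := by exact_mod_cast h'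
    omega
  · intro h'
    have : (-1 : ℤ) < a := by omega
    exact_mod_cast this

/-- The open unit cube as a `Set.pi`. [folklore] -/
theorem cube_eq_pi (n : ℕ) :
    {x : Fin n → ℝ | ∀ j, 0 < x j ∧ x j < 1} = Set.pi Set.univ fun _ => Ioo (0:ℝ) 1 := by
  ext x; simp [Set.mem_pi]

/-- The open unit cube has volume `1`. [folklore] -/
theorem volume_cube (n : ℕ) : volume {x : Fin n → ℝ | ∀ j, 0 < x j ∧ x j < 1} = 1 := by
  rw [cube_eq_pi, Real.volume_pi_Ioo]
  simp

/-- A monomial with integer exponents is continuous on the open unit cube. [folklore] -/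
theorem continuousOn_monomial (n : ℕ) (a : Fin n → ℤ) :
    ContinuousOn (fun x : Fin n → ℝ => ∏ j, x j ^ (a j)) {x : Fin n → ℝ | ∀ j, 0 < x j ∧ x j < 1} := by
  refine continuousOn_finsetProd _ fun j _ => ?_
  exact (continuous_apply j).continuousOn.zpow₀ _ fun x hx => Or.inl (hx j).1.ne'

/-- **X₂ `CubeMonomialIntegrability`** (stated verbatim).
[cite: HuberMullerStachPeriodsIII2015, Lemma 11.2.2] -/
theorem cubeMonomialIntegrability :
    ∀ (n : ℕ) (a : Fin n → ℤ) (u : (Fin n → ℝ) → ℝ) (U : Set (Fin n → ℝ)), IsOpen U → closure {x : Fin n → ℝ | ∀ j, 0 < x j ∧ x j < 1} ⊆ U → ContinuousOn u U → (∀ x ∈ U, u x ≠ 0) → MeasureTheory.IntegrableOn (fun x => u x * ∏ j, x j ^ (a j)) {x : Fin n → ℝ | ∀ j, 0 < x j ∧ x j < 1} → ∀ j, 0 ≤ a j := by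
  intro n a u U hU hcl hu hu0 hint j
  classical
  by_contra hneg
  replace hneg : a j < 0 := not_le.mp hneg
  set C : Set (Fin n → ℝ) := {x | ∀ j, 0 < x j ∧ x j < 1} with hC
  have hCo : IsOpen C := by
    rw [hC, cube_eq_pi]; exact isOpen_set_pi finite_univ fun _ _ => isOpen_Ioo
  have hCm : MeasurableSet C := hCo.measurableSet
  have hCb : Bornology.IsBounded C := by
    refine (isCompact_Icc (a := (0 : Fin n → ℝ)) (b := 1)).isBounded.subset fun x hx => ?_
    exact ⟨fun j => (hx j).1.le, fun j => (hx j).2.le⟩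
  have hCne : C.Nonempty := ⟨fun _ => 1/2, fun j => by norm_num⟩
  -- Step 1: strip the unit
  have hKc : IsCompact (closure C) := hCb.isCompact_closure
  obtain ⟨x₀, hx₀, hmin⟩ := hKc.exists_isMinOn hCne.closure
    ((continuous_abs.comp_continuousOn (hu.mono hcl)))
  set c : ℝ := |u x₀| with hc_def
  have hc : 0 < c := abs_pos.mpr (hu0 x₀ (hcl hx₀))
  have hcle : ∀ x ∈ C, c ≤ |u x| := fun x hx => hmin (subset_closure hx)
  set m : (Fin n → ℝ) → ℝ := fun x => ∏ j, x j ^ (a j) with hm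
  have hm_int : IntegrableOn m C := by
    have h1 : IntegrableOn (fun x => (u x)⁻¹ * (u x * m x)) C := by
      refine Integrable.bdd_mul (c := c⁻¹) hint ?_ ?_
      · exact ((hu.mono (subset_closure.trans hcl)).inv₀
          fun x hx => hu0 x (hcl (subset_closure hx))).aestronglyMeasurable hCm
      · filter_upwards [ae_restrict_mem hCm] with x hx
        rw [norm_inv, Real.norm_eq_abs]
        exact inv_anti₀ hc (hcle x hx)
    refine h1.congr_fun (fun x hx => ?_) hCm
    have : u x ≠ 0 := hu0 x (hcl (subset_closure hx))
    field_simp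
  -- Step 2: `n = n' + 1`
  obtain ⟨n', rfl⟩ : ∃ n', n = n' + 1 := ⟨n - 1, (Nat.succ_pred_eq_of_pos (Fin.pos j)).symm⟩
  -- Step 3: split off the coordinate `j`
  set C' : Set (Fin n' → ℝ) := {y | ∀ i, 0 < y i ∧ y i < 1} with hC'
  have hC'm : MeasurableSet C' := by
    rw [hC', cube_eq_pi]; exact MeasurableSet.univ_pi fun _ => measurableSet_Ioo
  set e := MeasurableEquiv.piFinSuccAbove (fun _ : Fin (n' + 1) => ℝ) j with he_def
  have he : MeasurePreserving e volume volume := volume_preserving_piFinSuccAbove (fun _ => ℝ) j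
  have he_apply : ∀ x : Fin (n' + 1) → ℝ, e x = (x j, fun i => x (j.succAbove i)) := fun x => rfl
  have hpre : e ⁻¹' (Ioo (0:ℝ) 1 ×ˢ C') = C := by
    ext x
    simp only [mem_preimage, he_apply, mem_prod, mem_Ioo, hC', hC, mem_setOf_eq]
    rw [Fin.forall_iff_succAbove j]
  set g : (Fin n' → ℝ) → ℝ := fun y => ∏ i, y i ^ (a (j.succAbove i)) with hg
  set F : ℝ × (Fin n' → ℝ) → ℝ := fun p => p.1 ^ (a j) * g p.2 with hF
  have hFm : ∀ x, F (e x) = m x := fun x => by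
    simp only [hF, hg, hm, he_apply]
    rw [Fin.prod_univ_succAbove _ j]
  have hF_int : IntegrableOn F (Ioo (0:ℝ) 1 ×ˢ C') (volume.prod volume) := by
    have h := (he.integrableOn_comp_preimage e.measurableEmbedding (f := F) (s := Ioo (0:ℝ) 1 ×ˢ C'))
    rw [hpre] at h
    rw [← Measure.volume_eq_prod]
    exact h.1 (hm_int.congr_fun (fun x _ => (hFm x).symm) hCm)
  -- Step 4: Tonelli on the product of restricted measures
  rw [IntegrableOn, ← Measure.prod_restrict] at hF_int
  have hf1 : AEMeasurable (fun t : ℝ => ‖t ^ (a j)‖ₑ) (volume.restrict (Ioo (0:ℝ) 1)) :=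
    ((continuousOn_id.zpow₀ _ fun t ht => Or.inl ht.1.ne').aemeasurable measurableSet_Ioo).enorm
  have hg2 : AEMeasurable (fun y => ‖g y‖ₑ) (volume.restrict C') :=
    ((continuousOn_monomial n' _).aemeasurable hC'm).enorm
  have hlin : ∫⁻ p, ‖F p‖ₑ ∂((volume.restrict (Ioo (0:ℝ) 1)).prod (volume.restrict C')) =
      (∫⁻ t, ‖t ^ (a j)‖ₑ ∂(volume.restrict (Ioo (0:ℝ) 1))) * ∫⁻ y, ‖g y‖ₑ ∂(volume.restrict C') := by
    rw [← lintegral_prod_mul hf1 hg2]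
    refine lintegral_congr fun p => ?_
    simp only [hF, enorm_mul]
  have hfin : (∫⁻ t, ‖t ^ (a j)‖ₑ ∂(volume.restrict (Ioo (0:ℝ) 1))) * ∫⁻ y, ‖g y‖ₑ ∂(volume.restrict C') < ∞ := by
    rw [← hlin]; exact hF_int.hasFiniteIntegral
  -- Step 5: both factors are non-zero
  have hL1 : (∫⁻ t, ‖t ^ (a j)‖ₑ ∂(volume.restrict (Ioo (0:ℝ) 1))) ≠ 0 := by
    intro h0
    have hae := (lintegral_eq_zero_iff' hf1).mp h0
    -- `t ^ a = 0` a.e. on `(0,1)`: impossible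
    have : ∀ᵐ t ∂(volume.restrict (Ioo (0:ℝ) 1)), False := by
      filter_upwards [hae, ae_restrict_mem measurableSet_Ioo] with t ht hmem
      have h1 : t ^ (a j) ≠ 0 := zpow_ne_zero _ hmem.1.ne'
      simp only [Pi.zero_apply, enorm_eq_zero] at ht
      exact h1 ht
    rw [eventually_false_iff_eq_bot, ae_eq_bot, Measure.restrict_eq_zero] at this
    simp at this
  have hL2 : (∫⁻ y, ‖g y‖ₑ ∂(volume.restrict C')) ≠ 0 := by
    intro h0
    have hae := (lintegral_eq_zero_iff' hg2).mp h0
    have : ∀ᵐ y ∂(volume.restrict C'), False := by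
      filter_upwards [hae, ae_restrict_mem hC'm] with y hy hmem
      have h1 : g y ≠ 0 := by
        simp only [hg]
        exact Finset.prod_ne_zero_iff.mpr fun i _ => zpow_ne_zero _ (hmem i).1.ne'
      simp only [Pi.zero_apply, enorm_eq_zero] at hy
      exact h1 hy
    rw [eventually_false_iff_eq_bot, ae_eq_bot, Measure.restrict_eq_zero] at this
    have hvol : volume C' = 1 := volume_cube n'
    rw [this] at hvol
    exact zero_ne_one hvol
  -- Step 6: hence `t ↦ t ^ a j` is integrable on `(0,1)`, so `0 ≤ a j`
  have hL1fin : (∫⁻ t, ‖t ^ (a j)‖ₑ ∂(volume.restrict (Ioo (0:ℝ) 1))) < ∞ := by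
    rcases ENNReal.mul_lt_top_iff.mp hfin with h | h | h
    · exact h.1
    · exact absurd h hL1
    · exact absurd h hL2
  have hInt : IntegrableOn (fun t : ℝ => t ^ (a j)) (Ioo (0:ℝ) 1) :=
    ⟨((continuousOn_id.zpow₀ _ fun t ht => Or.inl ht.1.ne').aestronglyMeasurable measurableSet_Ioo),
      hL1fin⟩
  have := (integrableOn_zpow_Ioo_iff (a j)).mp hInt
  omega

end Summit.KontsevichZagierPeriods.VeryGoodTransfer.CubeMonomialIntegrabilityProof
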